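import Summits.ValiantsHypothesis.ValiantsHypothesis.Theorems.MonotoneRestorationOrbitRestorationQPValueOrbitWideConverse
import Summits.ValiantsHypothesis.ValiantsHypothesis.Theorems.MonotoneRestorationOrbitRestorationQPValueOrbitProductTerms
import Summits.ValiantsHypothesis.ValiantsHypothesis.Theorems.MonotoneRestorationOrbitRestorationQPEquivariantTermsTools
import HarnessLib

/-!
# Equivariant block products of supported affine forms are orbit-restorable (ORBIT currency, XV)

Route MonotoneRestoration, crux `OrbitRestorationQP` (stmt-ValiantsHypothesis-18293), namespace
`Summit.ValiantsHypothesis.ValiantsHypothesis.Theorems.BlockProducts`.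

The restoration half of the `k = 1` sub-rung (ΠΣ) of the first rung of line `depth-three-rung`, as a
BLOCK CRITERION.  A diagonally symmetric product of affine forms `f = a · Π L` permutes its factors only up to
units (sign characters of the stabilisers of the factor lines), so the factor multiset `L` is in general NOT
an operand multiset of small orbit.  The cure is to multiply in BLOCKS: `f = a · Π_{b ∈ B} Π M_b` over a finite
`Sym(Fin n)`-set `B` of blocks such that

* every form in every block is affine and SUPPORTED by `≤ k` indices (automatic for the factors of a
  symmetric affine product, `AffineFactors.exists_support_of_mem_factors`);
* the operand multiset `M_b` of each block is permuted EXACTLY (not up to units) by the pointwise stabiliser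
  of `≤ k` indices;
* the block PRODUCTS are equivariant: `σ · Π M_b = Π M_{σ b}` (the units cancel inside each block).

Then (`qpOrbitRestorable_of_blocks`) `f` is `QPOrbitRestorable (k + 5)`: the wide derivation
variables/`1` → forms (sum steps, free) → block products (operand multisets of orbit `≤ (n+1)^k`) → their
product (operand multiset of orbit `1`) → `f` has orbit WIDTH `≤ (n+1)^k`, and `ValueOrbit.qpOrbit_of_wide`
applies.  Lemmas: `ncard_range_map_le_of_perm` (exactly permuted multisets have orbit `≤ (n+1)^k`),
`ren_prod_eq_of_perm`, `pow_succ_le_qp`.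

Everything is proved. [folklore]

## References
* A. Dawar, G. Wilsenach, *Symmetric arithmetic circuits*, ToC 21 (2025), §3.3, Def. 6.1. [DawarWilsenach2025]
-/

noncomputable section

open scoped Classical

-- `Summit.ValiantsHypothesis.ValiantsHypothesis.…` is the tree's single-conjunct layout (Sub = Summit).
set_option linter.dupNamespace false

namespace Summit.ValiantsHypothesis.ValiantsHypothesis.Theorems

namespace BlockProducts

open Equiv Finset Literature.Computability.AlgebraicComplexity OrbitRestorationQPDepthThreeRung

variable {n : ℕ}

/-! ### Orbits of exactly permuted multisets and of their products -/

/-- **An operand multiset permuted exactly by the pointwise stabiliser of `K` has at most `(n+1)^|K|`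
translates.** [folklore; cite: DawarWilsenach2025, Def. 6.1] -/
theorem ncard_range_map_le_of_perm {K : Finset (Fin n)} {M : Multiset (MvPolynomial (Fin n × Fin n) ℂ)}
    (hK : ∀ σ : Perm (Fin n), (∀ x ∈ K, σ x = x) → M.map (ren σ) = M) :
    (Set.range fun σ : Perm (Fin n) => M.map (ren σ)).ncard ≤ (n + 1) ^ K.card := by
  have hagree : ∀ σ τ : Perm (Fin n), (∀ i ∈ K, σ i = τ i) → M.map (ren σ) = M.map (ren τ) := by
    intro σ τ hστ
    have hfix : M.map (ren (τ⁻¹ * σ)) = M := hK (τ⁻¹ * σ) fun i hi => by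
      rw [Perm.mul_apply, hστ i hi]; exact τ.symm_apply_apply i
    have h := congrArg (Multiset.map (ren τ)) hfix
    rw [Multiset.map_map] at h
    rw [← h]
    refine Multiset.map_congr rfl fun q _ => ?_
    simp only [Function.comp_apply, ← ren_mul, mul_inv_cancel_left]
  refine (ncard_range_le_pow_of_agree K _ hagree).trans ?_
  rw [Fintype.card_fin]; exact Nat.pow_le_pow_left (Nat.le_succ n) _

/-- The product of an exactly permuted multiset is fixed by the same pointwise stabiliser. [folklore] -/
theorem ren_prod_eq_of_perm {K : Finset (Fin n)} {M : Multiset (MvPolynomial (Fin n × Fin n) ℂ)}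
    (hK : ∀ σ : Perm (Fin n), (∀ x ∈ K, σ x = x) → M.map (ren σ) = M) :
    ∀ σ : Perm (Fin n), (∀ x ∈ K, σ x = x) → ren σ M.prod = M.prod := fun σ hσ => by
  rw [map_multiset_prod, hK σ hσ]

/-- Arithmetic: `(n+1)^k ≤ 2^((log₂ n + k + 2)^(k+2))`. [folklore] -/
theorem pow_succ_le_qp (n k : ℕ) : (n + 1) ^ k ≤ 2 ^ ((Nat.log 2 n + (k + 2)) ^ (k + 2)) := by
  set L := Nat.log 2 n with hL
  have h1 : n + 1 ≤ 2 ^ (L + 1) := Nat.lt_pow_succ_log_self Nat.one_lt_two n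
  calc (n + 1) ^ k ≤ (2 ^ (L + 1)) ^ k := Nat.pow_le_pow_left h1 k
    _ = 2 ^ ((L + 1) * k) := (pow_mul 2 (L + 1) k).symm
    _ ≤ 2 ^ ((L + (k + 2)) ^ (k + 2)) := by
        refine Nat.pow_le_pow_right (by norm_num) ?_
        have h2 : (L + 1) * k ≤ (L + (k + 2)) ^ 2 := by rw [sq]; nlinarith
        exact h2.trans (Nat.pow_le_pow_right (by omega) (by omega))

/-- Arithmetic: `n · n ≤ 2^((log₂ n + k + 2)^(k+2))`. [folklore] -/
theorem sq_le_qp (n k : ℕ) : n * n ≤ 2 ^ ((Nat.log 2 n + (k + 2)) ^ (k + 2)) := by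
  refine (ValueOrbit.sq_le_pow_log n).trans (Nat.pow_le_pow_right (by norm_num) ?_)
  have h2 : 2 * Nat.log 2 n + 2 ≤ (Nat.log 2 n + (k + 2)) ^ 2 := by rw [sq]; nlinarith
  exact h2.trans (Nat.pow_le_pow_right (by omega) (by omega))

/-! ### The block criterion -/

/-- **EQUIVARIANT BLOCK PRODUCTS OF SUPPORTED AFFINE FORMS ARE ORBIT-RESTORABLE.**  Let `B` be a finite
`Sym(Fin n)`-set of blocks and `M_b` (`b ∈ B`) multisets of affine forms on the `n × n` matrix such that
(i) every form is fixed by the pointwise stabiliser of `≤ k` indices, (ii) every `M_b` is mapped to itself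
(exactly) by the pointwise stabiliser of `≤ k` indices, (iii) `σ · Π M_b = Π M_{σ • b}` for all `σ, b`.  Then
`a · Π_b Π M_b` is `QPOrbitRestorable (k + 5)` at level `n`.  (Sums are free and each product costs only the
orbit of its operand multiset: `≤ (n+1)^k` for the blocks, `1` for the product of the blocks.)
[folklore; cite: DawarWilsenach2025, §3.3] -/
theorem qpOrbitRestorable_of_blocks {k : ℕ} {B : Type} [Fintype B] [MulAction (Perm (Fin n)) B]
    (M : B → Multiset (MvPolynomial (Fin n × Fin n) ℂ)) (a : ℂ)
    (hAff : ∀ b, ∀ q ∈ M b, q.totalDegree ≤ 1)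
    (hSupp : ∀ b, ∀ q ∈ M b, ∃ X : Finset (Fin n), X.card ≤ k ∧
      ∀ σ : Perm (Fin n), (∀ x ∈ X, σ x = x) → ren σ q = q)
    (hPerm : ∀ b, ∃ K : Finset (Fin n), K.card ≤ k ∧
      ∀ σ : Perm (Fin n), (∀ x ∈ K, σ x = x) → (M b).map (ren σ) = M b)
    (hEqv : ∀ (σ : Perm (Fin n)) (b : B), ren σ (M b).prod = (M (σ • b)).prod) :
    QPOrbitRestorable (k + 5) n (MvPolynomial.C a * ∏ b, (M b).prod) := by
  set L := Nat.log 2 n with hL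
  set Bw := 2 ^ ((L + (k + 2)) ^ (k + 2)) with hBw
  have hBw1 : 1 ≤ Bw := Nat.one_le_two_pow
  have hpow : ∀ {j : ℕ}, j ≤ k → (n + 1) ^ j ≤ Bw := fun hj =>
    (Nat.pow_le_pow_right (Nat.succ_pos n) hj).trans (pow_succ_le_qp n k)
  -- the values
  set P : MvPolynomial (Fin n × Fin n) ℂ := ∏ b, (M b).prod with hP
  set f : MvPolynomial (Fin n × Fin n) ℂ := MvPolynomial.C a * P with hf
  set S0 : Finset (MvPolynomial (Fin n × Fin n) ℂ) :=
    insert (MvPolynomial.C 1) ((univ : Finset (Fin n × Fin n)).image MvPolynomial.X) with hS0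
  set S1 : Finset (MvPolynomial (Fin n × Fin n) ℂ) := (univ : Finset B).biUnion fun b => (M b).toFinset
    with hS1
  set S2 : Finset (MvPolynomial (Fin n × Fin n) ℂ) := (univ : Finset B).image fun b => (M b).prod with hS2
  set S : Finset (MvPolynomial (Fin n × Fin n) ℂ) := S0 ∪ S1 ∪ S2 ∪ {P, f} with hS
  set rank : MvPolynomial (Fin n × Fin n) ℂ → ℕ := fun q =>
    if q ∈ S0 then 0 else if q ∈ S1 then 1 else if q ∈ S2 then 2 else if q = P then 3 else 4 with hrank
  -- invariance of `P` and `f`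
  have hPfix : ∀ σ : Perm (Fin n), ren σ P = P := by
    intro σ
    rw [hP, map_prod]
    simp only [hEqv]
    exact Fintype.prod_equiv (MulAction.toPerm σ) _ _ fun b => rfl
  have hffix : ∀ σ : Perm (Fin n), ren σ f = f := fun σ => by rw [hf, map_mul, ren_C, hPfix]
  -- membership facts
  have hC1 : MvPolynomial.C 1 ∈ S0 := Finset.mem_insert_self _ _
  have hXm : ∀ p, MvPolynomial.X p ∈ S0 := fun p =>
    Finset.mem_insert_of_mem (Finset.mem_image.2 ⟨p, Finset.mem_univ p, rfl⟩)
  have hS0S : S0 ⊆ S := by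
    intro q hq; simp only [hS, Finset.mem_union]; exact Or.inl (Or.inl (Or.inl hq))
  have hS1S : S1 ⊆ S := by
    intro q hq; simp only [hS, Finset.mem_union]; exact Or.inl (Or.inl (Or.inr hq))
  have hS2S : S2 ⊆ S := by
    intro q hq; simp only [hS, Finset.mem_union]; exact Or.inl (Or.inr hq)
  have hPS : P ∈ S := by simp [hS]
  have hfS : f ∈ S := by simp [hS]
  have hmemS1 : ∀ b, ∀ q ∈ M b, q ∈ S1 := fun b q hq =>
    Finset.mem_biUnion.2 ⟨b, Finset.mem_univ b, Multiset.mem_toFinset.2 hq⟩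
  have hmemS2 : ∀ b, (M b).prod ∈ S2 := fun b => Finset.mem_image.2 ⟨b, Finset.mem_univ b, rfl⟩
  have hrank0 : ∀ q ∈ S0, rank q = 0 := fun q hq => by simp only [hrank, if_pos hq]
  have hrank1 : ∀ q ∈ S1, rank q ≤ 1 := fun q hq => by
    simp only [hrank]; split_ifs <;> omega
  have hrank2 : ∀ q ∈ S2, rank q ≤ 2 := fun q hq => by
    simp only [hrank]; split_ifs <;> omega
  have hrankP : rank P ≤ 3 := by simp only [hrank]; split_ifs <;> omega
  -- orbit of an invariant
  have horb_inv : ∀ {q : MvPolynomial (Fin n × Fin n) ℂ}, (∀ σ : Perm (Fin n), ren σ q = q) →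
      (Set.range fun σ : Perm (Fin n) => ren σ q).ncard ≤ Bw := fun hq =>
    (ValueOrbit.ncard_orbit_of_invariant hq).trans hBw1
  -- THE WIDTH STATEMENT
  have W : ∀ q ∈ S, (Set.range fun σ : Perm (Fin n) => ren σ q).ncard ≤ Bw ∧
      ∃ d : WStep ℂ (Fin n × Fin n), d.Valid S rank q ∧
        ∀ N, d = WStep.prod N → (Set.range fun σ : Perm (Fin n) => N.map (ren σ)).ncard ≤ Bw := by
    intro q hq
    by_cases h0 : q ∈ S0
    · -- variables and the constant `1`
      rcases Finset.mem_insert.1 h0 with rfl | hx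
      · refine ⟨horb_inv fun σ => ren_C σ 1, WStep.const 1, ⟨rfl, fun u hu => by simp [WStep.args] at hu⟩,
          fun N h => by cases h⟩
      · obtain ⟨p, -, rfl⟩ := Finset.mem_image.1 hx
        refine ⟨?_, WStep.var p, ⟨rfl, fun u hu => by simp [WStep.args] at hu⟩, fun N h => by cases h⟩
        refine le_trans ?_ ((ValueOrbit.ncard_orbit_var_le n p).trans (sq_le_qp n k))
        exact TermCircuit.ncard_range_le_of_factor _ (fun σ : Perm (Fin n) => σ • p) MvPolynomial.X
          fun σ => ren_X σ p
    by_cases h1 : q ∈ S1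
    · -- an affine form: one (free) sum step from the variables and `1`
      obtain ⟨b, -, hqb⟩ := Finset.mem_biUnion.1 h1
      have hqM : q ∈ M b := Multiset.mem_toFinset.1 hqb
      have hrq : rank q = 1 := by simp only [hrank, if_neg h0, if_pos h1]
      refine ⟨?_, WStep.sum ((MvPolynomial.coeff 0 q, MvPolynomial.C 1) ::ₘ
        ((univ : Finset (Fin n × Fin n)).val.map fun p => (MvPolynomial.coeff (Finsupp.single p 1) q,
          MvPolynomial.X p))), ⟨?_, fun u hu => ?_⟩, fun N h => by cases h⟩
      · obtain ⟨X, hXk, hX⟩ := hSupp b q hqM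
        exact (ValueOrbit.orbit_bounded_of_supported hX).trans (hpow hXk)
      · rw [WStep.value, Multiset.map_cons, Multiset.sum_cons, Multiset.map_map, map_one, mul_one]
        conv_rhs => rw [eqvTerms_affine_eq q (hAff b q hqM), Finset.sum_eq_multiset_sum]
        rfl
      · simp only [WStep.args, Multiset.map_cons, Multiset.map_map, Function.comp_def, Multiset.mem_cons,
          Multiset.mem_map, Finset.mem_val, Finset.mem_univ, true_and] at hu
        have hu0 : u ∈ S0 := by
          rcases hu with rfl | ⟨p, rfl⟩
          · exact hC1
          · exact hXm p
        exact ⟨hS0S hu0, by rw [hrank0 u hu0, hrq]; exact Nat.zero_lt_one⟩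
    by_cases h2 : q ∈ S2
    · -- a block product: operand multiset exactly permuted by a small pointwise stabiliser
      obtain ⟨b, -, rfl⟩ := Finset.mem_image.1 h2
      obtain ⟨K, hKk, hK⟩ := hPerm b
      have hrq : rank (M b).prod = 2 := by simp only [hrank, if_neg h0, if_neg h1, if_pos h2]
      refine ⟨(ValueOrbit.orbit_bounded_of_supported (ren_prod_eq_of_perm hK)).trans (hpow hKk),
        WStep.prod (M b), ⟨rfl, fun u hu => ?_⟩, fun N h => ?_⟩
      · have hu1 : u ∈ S1 := hmemS1 b u hu
        exact ⟨hS1S hu1, by rw [hrq]; exact Nat.lt_of_le_of_lt (hrank1 u hu1) (by norm_num)⟩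
      · cases h
        exact (ncard_range_map_le_of_perm hK).trans (hpow hKk)
    by_cases h3 : q = P
    · -- the product of the blocks: an invariant operand multiset
      subst h3
      have hrq : rank P = 3 := by simp only [hrank, if_neg h0, if_neg h1, if_neg h2, if_true]
      set N₀ : Multiset (MvPolynomial (Fin n × Fin n) ℂ) := (univ : Finset B).val.map fun b => (M b).prod
        with hN₀
      have hN₀fix : ∀ σ : Perm (Fin n), N₀.map (ren σ) = N₀ := by
        intro σ
        rw [hN₀, Multiset.map_map]
        have hc : (ren σ) ∘ (fun b => (M b).prod) = (fun b => (M b).prod) ∘ (MulAction.toPerm σ) := by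
          funext b; simp only [Function.comp_apply, hEqv, MulAction.toPerm_apply]
        rw [hc, ← Multiset.map_map, Multiset.map_univ_val_equiv]
      refine ⟨horb_inv hPfix, WStep.prod N₀, ⟨?_, fun u hu => ?_⟩, fun N h => ?_⟩
      · rw [WStep.value, hN₀, hP, Finset.prod_eq_multiset_prod]
      · rw [WStep.args, hN₀] at hu
        simp only [Multiset.mem_map, Finset.mem_val, Finset.mem_univ, true_and] at hu
        obtain ⟨b, rfl⟩ := hu
        exact ⟨hS2S (hmemS2 b), by rw [hrq]; exact Nat.lt_of_le_of_lt (hrank2 _ (hmemS2 b)) (by norm_num)⟩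
      · cases h
        rw [show (Set.range fun σ : Perm (Fin n) => N₀.map (ren σ)) = {N₀} from ?_]
        · rw [Set.ncard_singleton]; exact hBw1
        · ext N; simp only [Set.mem_range, hN₀fix, Set.mem_singleton_iff, exists_const, eq_comm]
    · -- the output `f = a · P`: a (free) sum step
      have hqf : q = f := by
        simp only [hS, Finset.mem_union, Finset.mem_insert, Finset.mem_singleton] at hq
        rcases hq with ((hq | hq) | hq) | hq | hq
        · exact absurd hq h0
        · exact absurd hq h1
        · exact absurd hq h2
        · exact absurd hq h3
        · exact hq
      subst hqf
      have hrq : rank f = 4 := by simp only [hrank, if_neg h0, if_neg h1, if_neg h2, if_neg h3]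
      refine ⟨horb_inv hffix, WStep.sum ((a, P) ::ₘ 0), ⟨?_, fun u hu => ?_⟩, fun N h => by cases h⟩
      · simp only [WStep.value, Multiset.map_cons, Multiset.map_zero, Multiset.sum_cons, Multiset.sum_zero,
          add_zero, hf]
      · simp only [WStep.args, Multiset.map_cons, Multiset.map_zero, Multiset.mem_cons,
          Multiset.notMem_zero, or_false] at hu
        subst hu
        exact ⟨hPS, by rw [hrq]; exact Nat.lt_of_le_of_lt hrankP (by norm_num)⟩
  -- the wide derivation and its width
  let 𝒲 : WideDerivation ℂ (Fin n × Fin n) :=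
    { S := S, rank := rank, step := fun q hq => by
        obtain ⟨-, d, hd, -⟩ := W q hq
        exact ⟨d, hd⟩ }
  have hW : 𝒲.OrbitWidthLE (Perm (Fin n)) Bw := fun q hq => W q hq
  obtain ⟨G, inst, C, hC, hev, horb⟩ := ValueOrbit.qpOrbit_of_wide (c := k + 2) 𝒲 hfS hffix hW
  exact ⟨G, inst, C, hC, hev, horb⟩

end BlockProducts

end Summit.ValiantsHypothesis.ValiantsHypothesis.Theorems

end
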